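import Literature.Topology.FourManifolds.ComplexProjectiveSpaceProofs
import Mathlib.Geometry.Manifold.ContMDiff.Atlas
import Mathlib.Geometry.Manifold.ContMDiff.NormedSpace

/-!
# The glued sphere `F : ℂℙ¹ → M` is smooth
(helper `helper_gluedSphereContMDiff` of line `cross-cap-laurent`, crux `GromovRecognitionRelEnd`,
item stmt-SmoothPoincare4-11009; piece W1 of the `π₂`-consumption lemma `helper_noJSpheres`)

A `J`-holomorphic sphere given in two-chart form `u v : ℂ → M` (`v z = u z⁻¹`) in a smooth
`4`-manifold `M` is glued into one map `F : ℂℙ¹ → M` on the tree's complex projective line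
`Literature.Topology.FourManifolds.ComplexProjectiveSpace 1` (charted on
`EuclideanSpace ℝ (Fin (2 * 1))`, model `𝓡 (2 * 1)`), characterised by
`F [w₀ : w₁] = u (w₁ / w₀)` on `{w₀ ≠ 0}` and `F [w₀ : w₁] = v (w₀ / w₁)` on `{w₁ ≠ 0}`.
This file proves that such an `F` is `C^∞` when `u` and `v` are.

Proof: the two affine chart sources `{p | CoordNeZero i p}` (`i = 0, 1`) are open and cover `ℂℙ¹`
(`exists_coordNeZero`); on the source of the chart `i`, `F` is `uᵢ` precomposed with the complex
affine coordinate `p ↦ ((realCoordinates 1)⁻¹ (affineChart i p)) 0`, i.e. a continuous linear map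
`ℝ² ≅ ℂ¹ → ℂ` after a chart of the atlas (`contMDiffAt_of_mem_maximalAtlas`), hence smooth at
every point of that source (`ContMDiffAt.congr_of_eventuallyEq`).

References: P. Griffiths, J. Harris, *Principles of Algebraic Geometry* (1978), Ch. 0 §2 (affine
charts of `ℙⁿ`); D. McDuff, D. Salamon, *J-holomorphic Curves and Symplectic Topology*, 2nd ed.
(2012), §4.2 (spheres as maps of `S² = ℂ ∪ {∞}` through the two charts `z`, `1/z`).
-/

noncomputable section

-- the prescribed namespace `Summit.<P>.<Sub>.…` duplicates `SmoothPoincare4` (P = Sub)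
set_option linter.dupNamespace false

open scoped Manifold ContDiff Topology
open Set Function
open Literature.Topology.FourManifolds Literature.Topology.FourManifolds.ComplexProjectiveSpace

namespace Summit.SmoothPoincare4.SmoothPoincare4.Theorems.GromovRecognitionRelEnd.CrossCapLaurent

/-- **Smoothness of the glued map on one affine chart.** If `F = u ∘ cᵢ` on the source
`{[w] | wᵢ ≠ 0}` of the `i`-th affine chart of `ℂℙ¹`, where `cᵢ p = affineCoordComplex i p 0` is
the complex affine coordinate and `u : ℂ → M` is `C^∞`, then `F` is `C^∞` at every point of that
source: there `F = u ∘ (w ↦ ((realCoordinates 1)⁻¹ w) 0) ∘ affineChart i`, a smooth map after a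
continuous linear map after a chart of the analytic atlas (Griffiths–Harris, Ch. 0 §2). [folklore] -/
theorem contMDiffAt_gluedSphere_of_coordNeZero {M : Type} [TopologicalSpace M]
    [ChartedSpace (EuclideanSpace ℝ (Fin 4)) M] {u : ℂ → M}
    {F : ComplexProjectiveSpace 1 → M} (i : Fin (1 + 1)) (hu : ContMDiff 𝓘(ℝ, ℂ) (𝓡 4) ∞ u)
    (hF : ∀ p, CoordNeZero i p → F p = u (affineCoordComplex i p 0))
    {p : ComplexProjectiveSpace 1} (hp : CoordNeZero i p) :
    ContMDiffAt (𝓡 (2 * 1)) (𝓡 4) ∞ F p := by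
  have hp' : p ∈ (affineChart i).source := hp
  have he : affineChart i ∈
      IsManifold.maximalAtlas (𝓡 (2 * 1)) ∞ (ComplexProjectiveSpace 1) :=
    IsManifold.subset_maximalAtlas ⟨i, rfl⟩
  have h1 : ContMDiffAt (𝓡 (2 * 1)) (𝓡 (2 * 1)) ∞ (affineChart i) p :=
    contMDiffAt_of_mem_maximalAtlas he hp'
  -- the complex affine coordinate read on the real model plane is a continuous linear map
  have h2 : ContMDiff (𝓡 (2 * 1)) 𝓘(ℝ, ℂ) ∞
      (fun w : EuclideanSpace ℝ (Fin (2 * 1)) => (realCoordinates 1).symm w 0) :=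
    ((contDiff_apply ℝ ℂ (0 : Fin 1)).comp (realCoordinates 1).symm.contDiff).contMDiff
  have h3 : ContMDiffAt (𝓡 (2 * 1)) (𝓡 4) ∞
      ((u ∘ fun w : EuclideanSpace ℝ (Fin (2 * 1)) => (realCoordinates 1).symm w 0) ∘
        affineChart i) p :=
    (hu.comp h2).contMDiffAt.comp p h1
  refine h3.congr_of_eventuallyEq ?_
  filter_upwards [(affineChart i).open_source.mem_nhds hp'] with q hq
  have hq' : CoordNeZero i q := hq
  simp only [comp_apply, hF q hq', affineChart_apply, affineCoord,
    ContinuousLinearEquiv.symm_apply_apply]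

/-- **The glued sphere is smooth** (registered stub `helper_gluedSphereContMDiff` of line
`cross-cap-laurent`, signature verbatim; piece W1 of `helper_noJSpheres`). For a smooth `4`-manifold
`M`, smooth `u v : ℂ → M` and a map `F : ℂℙ¹ → M` with `F [w₀ : w₁] = u (w₁ / w₀)` on `{w₀ ≠ 0}` and
`F [w₀ : w₁] = v (w₀ / w₁)` on `{w₁ ≠ 0}`, the map `F` is `C^∞` for the analytic structure of the
tree's `ComplexProjectiveSpace 1` (model `𝓡 (2 * 1)`): the two affine chart sources cover `ℂℙ¹`
(`exists_coordNeZero`) and on each of them `F` is smooth by `contMDiffAt_gluedSphere_of_coordNeZero`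
(McDuff–Salamon 2012, §4.2; Griffiths–Harris, Ch. 0 §2). The compatibility `v z = u z⁻¹` is not
needed for smoothness (it is what makes such an `F` exist) and the `IsManifold` instance on `M` is
carried only because the registered signature has it. [folklore] -/
theorem helper_gluedSphereContMDiff : ∀ (M : Type) [TopologicalSpace M] [ChartedSpace (EuclideanSpace ℝ (Fin 4)) M] [IsManifold (𝓡 4) ∞ M] (u v : ℂ → M) (F : Literature.Topology.FourManifolds.ComplexProjectiveSpace 1 → M), ContMDiff 𝓘(ℝ, ℂ) (𝓡 4) ∞ u → ContMDiff 𝓘(ℝ, ℂ) (𝓡 4) ∞ v → (∀ p, Literature.Topology.FourManifolds.ComplexProjectiveSpace.CoordNeZero 0 p → F p = u (Literature.Topology.FourManifolds.ComplexProjectiveSpace.affineCoordComplex 0 p 0)) → (∀ p, Literature.Topology.FourManifolds.ComplexProjectiveSpace.CoordNeZero 1 p → F p = v (Literature.Topology.FourManifolds.ComplexProjectiveSpace.affineCoordComplex 1 p 0)) → ContMDiff (𝓡 (2 * 1)) (𝓡 4) ∞ F := by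
  intro M _ _ _ u v F hu hv hF0 hF1 p
  rcases Fin.exists_fin_two.1 (exists_coordNeZero p) with hp | hp
  · exact contMDiffAt_gluedSphere_of_coordNeZero 0 hu hF0 hp
  · exact contMDiffAt_gluedSphere_of_coordNeZero 1 hv hF1 hp

end Summit.SmoothPoincare4.SmoothPoincare4.Theorems.GromovRecognitionRelEnd.CrossCapLaurent

end
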